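import Summits.Ventures.CertifiedManyBodySolver.Cruxes.ThermalStiffnessCeilingU8b10_le_1o8.SeamCumulantCertificate
import HarnessLib

/-!
# BN-decomp-3 — the CERT-3×3 node of record READ THROUGH the floor-set normal form: `3 ∈ floorSet 0 8 (7/8) 10 ρ 10⁻⁹` for every `ρ ≤ 0.217`

Planner `hubbard-floor-idea-decomp` g10 (lens = decomposition-first; ZERO kit; no routes; cycle 11 = found-nothing for a new lever). This file is the
one BOOKKEEPING hook that fired this cycle (FL-RULING 52 cc idea-decomp «CERT-3×3 node pending readers»): it instantiates BN-decomp-1 §4's socket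
(`FloorSetNormalForm.mem_floorSet_of_quadFloor`, v1.1 dc73a43ae837593a) with the NODE OF RECORD `Cert3x3SeamNumbersNode.cert_k1Sector3_seamTwoNumbers_U8_b10_j319450_j319502`
(sha16 e55ca251701fcf13, crux write adf61a42db28; booked FLOOR-TABLE v7.5 / PREREG v1.38) through BN-resc-2's sorry-free reduction
`SeamCumulantCertificate.fluxCostQuadFloorAt_of_threeNumbers 3` (`qA := 144` PROVED). HONEST FRAMING: restatement-grade glue; nothing about superconductivity
in the Hubbard model is proved or disproved here (it is NOT proved); the route crux K1 = `TcThermcert1.ThermalStiffnessCeilingU8b10_le_1o8`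
(stmt-Ventures-26381) is UNTOUCHED (`FloorSetNormalForm.k1_iff_sizes_ge_four`: K1 sees only floor sets cut to sizes `L ≥ 4`); «(3,3) sector» is a
particle-number sector of the 3×3 torus, not a filling word; no number below is a new cell of record — the only inputs are the node's two booked
rationals `177/100`, `133/1000` and the proved `144`.

THE READING (all modulo the node, taken as the hypothesis `certNode`):
* Step 1 `fluxCostQuadFloorAt_three` / `_217`: the node ⇒ the θ-UNIFORM quadratic floor `a·θ² ≤ g₃(θ)` on `|θ| ≤ 10⁻⁹` for `a = 2`, indeed for
  `a = 217/100` (side condition `a ≤ 5κlo − 50qB − loss(10⁻⁹) = 8.85 − 6.65 − 0.02765… = 2.1723…`, `norm_num`; `a = 2.18` would NOT pass on this window);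
* Step 2 `three_mem_floorSet`: hence `3 ∈ floorSet 0 8 (7/8) 10 ρ 10⁻⁹` for every trial slope `ρ ≤ 217/1000` (`β ρ = 10ρ ≤ a`) — in particular at
  `ρ = 1/5 > 1/8` the super-⅛ floor set `floorSet 0 8 (7/8) 10 (1/5) 10⁻⁹` is NON-EMPTY (`floorSet_fifth_nonempty`): the cell's first certified MEMBER
  of a K1 floor set;
* Step 3 `not_k1WithoutTendstoPos_reading`: a non-empty super-⅛ floor set is exactly `¬ K1WithoutTendstoPos` (→ direction of
  `FloorSetNormalForm.k1WithoutTendstoPos_iff_empty`) — the node file's own decision `not_k1WithoutTendstoPos_of_cert3x3`, re-derived in the normal form;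
* Silence on K1: K1 ⇔ `∀ ρ > 1/8, ∀ θ₀ > 0, BddAbove (floorSet … ρ θ₀ ∩ Ici 4)` (`k1_iff_sizes_ge_four`), and `3 ∉ Ici 4`. One member at one small size
  says nothing about boundedness of the set of LARGE members, which is the thermodynamic-limit content of K1 (`k1_iff_eventually_dip`).
ERRATUM to the r10 pointer: `FloorSetNormalForm.mem_floorSet_three_of_cert3` is NOT the applicable lemma — its hypothesis is the SUPERSEDED commissioned
shape `CertFluxCost3x3Floor` (slope 2 on the window `1/100`, FL-RULING 25); the node of record certifies θ = 0 numbers and BN-resc-2's cubic-Taylor route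
carries them to the window `10⁻⁹` only. Any window feeds the decider, so nothing is lost; the floor-set coordinates of the instance are `(ρ ≤ 0.217, θ₀ = 10⁻⁹)`.
SNAPSHOT NOTE: at check time `FloorSetNormalForm` and `Cert3x3SeamNumbersNode` were not in the farm's built import snapshot (`remote:stale:648:unbuilt`),
so the five declarations used from them are COPIED verbatim below (same bodies ⇒ definitionally equal; `Iff.rfl`/`rfl` bridge them once both build);
the only import is `SeamCumulantCertificate` (built).
-/

noncomputable section

open scoped Matrix.Norms.L2Operator ComplexOrder
open Matrix Literature.MathematicalPhysics.QuantumLattice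
open Real Filter Set Topology
open Summit.Ventures.CertifiedManyBodySolver.Observables Summit.Ventures.CertifiedManyBodySolver.Theses
open Summit.Ventures.CertifiedManyBodySolver.Cruxes.ThermalStiffnessCeilingU8b10_le_1o8.Disproof
open Summit.Ventures.CertifiedManyBodySolver.Cruxes.ThermalStiffnessCeilingU8b10_le_1o8.SeamCumulantCertificate

namespace Summit.Ventures.CertifiedManyBodySolver.Cruxes.ThermalStiffnessCeilingU8b10_le_1o8.Cert3x3FloorSetReading

/-- (copy of `Cert3x3SeamNumbersNode.SeamNumbersTwo3x3`) -/
def SeamNumbersTwo3x3 (κlo qB : ℝ) : Prop :=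
  κlo ≤ (gibbsState 10 ((hubbardTorusTT'Flux 3 0 8 0).toBlock (k1Sector 3) (k1Sector 3))
      ((seamHop 3).toBlock (k1Sector 3) (k1Sector 3))).re ∧
  (duhamel 10 ((hubbardTorusTT'Flux 3 0 8 0).toBlock (k1Sector 3) (k1Sector 3))
      ((seamCurrent 3).toBlock (k1Sector 3) (k1Sector 3)) ((seamCurrent 3).toBlock (k1Sector 3) (k1Sector 3))).re ≤ qB

/-- (copy of the node's Prop `cert_k1Sector3_seamTwoNumbers_U8_b10_j319450_j319502`, taken as a hypothesis below) -/
def certNode : Prop := SeamNumbersTwo3x3 (177 / 100) (133 / 1000)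

/-- (copy of `Cert3x3SeamNumbersNode.re_duhamel_seamHop_le_144`, PROVED) -/
theorem re_duhamel_seamHop_le_144 :
    (duhamel 10 ((hubbardTorusTT'Flux 3 0 8 0).toBlock (k1Sector 3) (k1Sector 3))
      ((seamHop 3).toBlock (k1Sector 3) (k1Sector 3)) ((seamHop 3).toBlock (k1Sector 3) (k1Sector 3))).re ≤ 144 := by
  haveI := nonempty_k1Sector 3
  have hMh : ((hubbardTorusTT'Flux 3 0 8 0).toBlock (k1Sector 3) (k1Sector 3)).IsHermitian :=
    (isHermitian_hubbardTorusTT'Flux (L := 3) 0 8 0).submatrix _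
  have hn : ‖(seamHop 3).toBlock (k1Sector 3) (k1Sector 3)‖ ≤ 4 * (3 : ℕ) := norm_seamHop_toBlock_le 3 _
  have h := Matrix.norm_duhamel_le hMh (by norm_num : (0 : ℝ) ≤ 10)
    ((seamHop 3).toBlock (k1Sector 3) (k1Sector 3)) ((seamHop 3).toBlock (k1Sector 3) (k1Sector 3))
  have h144 : ‖(seamHop 3).toBlock (k1Sector 3) (k1Sector 3)‖ * ‖(seamHop 3).toBlock (k1Sector 3) (k1Sector 3)‖ ≤ 144 := by
    have hn' : ‖(seamHop 3).toBlock (k1Sector 3) (k1Sector 3)‖ ≤ 12 := hn.trans (by norm_num)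
    nlinarith [norm_nonneg ((seamHop 3).toBlock (k1Sector 3) (k1Sector 3))]
  exact (Complex.re_le_norm _).trans (h.trans h144)

/-- (copy of `FloorSetNormalForm.floorSet`) -/
def floorSet (tp U n β ρ θ₀ : ℝ) : Set ℕ :=
  {L | ∃ _ : NeZero L, ∀ θ : ℝ, |θ| ≤ θ₀ →
    β * ρ * θ ^ 2 ≤ thermalFluxLogZ L tp U (1 - n) β 0 - thermalFluxLogZ L tp U (1 - n) β θ}

/-- (copy of `FloorSetNormalForm.mem_floorSet_of_quadFloor`, specialised to the K1 anchor through `fluxCost`) -/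
theorem mem_floorSet_of_quadFloor {ρ θ₀ a : ℝ} {L : ℕ} [NeZero L] (ha : 10 * ρ ≤ a)
    (h : ∀ θ : ℝ, |θ| ≤ θ₀ → a * θ ^ 2 ≤ fluxCost L θ) : L ∈ floorSet 0 8 (7 / 8) 10 ρ θ₀ :=
  ⟨inferInstance, fun θ hθ => (mul_le_mul_of_nonneg_right ha (sq_nonneg θ)).trans (h θ hθ)⟩

/-- Step 1: the node ⇒ the quadratic floor of slope `2` on the window `10⁻⁹` at `L = 3` (hnum: `2 ≤ 8.85 − 6.65 − 0.02765…`). -/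
theorem fluxCostQuadFloorAt_three (h : certNode) : FluxCostQuadFloorAt 3 (1 / 10 ^ 9) 2 :=
  fluxCostQuadFloorAt_of_threeNumbers 3 (κlo := 177 / 100) (qA := 144) (qB := 133 / 1000) (θ₀ := 1 / 10 ^ 9) (a := 2)
    (by norm_num) (by norm_num) (by norm_num) (by norm_num) (by norm_num) h.1 re_duhamel_seamHop_le_144 h.2 (by norm_num)

/-- The largest "round" admissible slope on that window: `a = 2.17` still passes, `a = 2.18` would not (loss = 0.0276…; 2.2 − 0.02765 = 2.1723…). -/
theorem fluxCostQuadFloorAt_three_217 (h : certNode) : FluxCostQuadFloorAt 3 (1 / 10 ^ 9) (217 / 100) :=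
  fluxCostQuadFloorAt_of_threeNumbers 3 (κlo := 177 / 100) (qA := 144) (qB := 133 / 1000) (θ₀ := 1 / 10 ^ 9) (a := 217 / 100)
    (by norm_num) (by norm_num) (by norm_num) (by norm_num) (by norm_num) h.1 re_duhamel_seamHop_le_144 h.2 (by norm_num)

/-- Step 2: hence `3 ∈ floorSet 0 8 (7/8) 10 ρ 10⁻⁹` for every trial slope `ρ ≤ 217/1000` (`β ρ = 10 ρ ≤ 2.17`). -/
theorem three_mem_floorSet (h : certNode) {ρ : ℝ} (hρ : ρ ≤ 217 / 1000) : 3 ∈ floorSet 0 8 (7 / 8) 10 ρ (1 / 10 ^ 9) :=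
  mem_floorSet_of_quadFloor (a := 217 / 100) (by linarith) fun θ hθ => fluxCostQuadFloorAt_three_217 h θ hθ

/-- In particular the super-⅛ floor set at `(ρ, θ₀) = (1/5, 10⁻⁹)` contains `3`, so is NON-EMPTY. -/
theorem floorSet_fifth_nonempty (h : certNode) : (floorSet 0 8 (7 / 8) 10 (1 / 5) (1 / 10 ^ 9)).Nonempty :=
  ⟨3, three_mem_floorSet h (by norm_num)⟩

/-- Step 3: a non-empty floor set with `ρ > 1/8` is exactly `¬ K1WithoutTendstoPos` (→ direction of `k1WithoutTendstoPos_iff_empty`, copied). -/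
theorem not_k1WithoutTendstoPos_of_mem {ρ θ₀ : ℝ} {L : ℕ} (hρ : 1 / 8 < ρ) (hθ : 0 < θ₀)
    (hL : L ∈ floorSet 0 8 (7 / 8) 10 ρ θ₀) : ¬ K1WithoutTendstoPos := by
  intro hK
  obtain ⟨inst, hfl⟩ := hL
  have h1 := hK ρ θ₀ (by linarith) hθ (fun _ => L) (fun _ => Nat.pos_of_ne_zero (NeZero.ne L))
    (fun j _ θ hθ' => hfl θ hθ')
  push_cast at h1
  linarith

theorem not_k1WithoutTendstoPos_reading (h : certNode) : ¬ K1WithoutTendstoPos :=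
  not_k1WithoutTendstoPos_of_mem (by norm_num) (by norm_num) (three_mem_floorSet h (show (1 / 5 : ℝ) ≤ 217 / 1000 by norm_num))

end Summit.Ventures.CertifiedManyBodySolver.Cruxes.ThermalStiffnessCeilingU8b10_le_1o8.Cert3x3FloorSetReading
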